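import Summits.QuantumFields.BalabanUV.T4Continuum.Spine.NE4.KingCurrency
import Summits.QuantumFields.BalabanUV.T4Continuum.Spine.NE4.KingCurrencyAF
import Literature.MathematicalPhysics.QuantumFieldTheory.Balaban1983to89.T4CouplingAnalyticity

/-!
# Spine/NE4/KingCurrencyGap — node U2 in King's currency WITHOUT THE ASYMPTOTIC-FREEDOM BINDER: the infrared-anchored
# fixed point with a growing envelope (memory rate `θ` < envelope rate `τ` < 1), and the direct matching of two pinned runs
# `n` cutoffs apart on an infrared window, uniformly in `n`, from `UniformShift ω` + fading memory + ONE window in `γ` alone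

Cell `pub-balaban-gaps` (YM blitz G2), seat `ne4` generation 14 (unit `pub-balaban-gaps-ne4-g14`), record `HOME/ne/NE4.md` §5 census
item (R52); sequel of `Spine/NE4/KingCurrency` (p383722: `UniformShift`, `discAt`, `discAt_step`, `king_fixedPoint`) and
`Spine/NE4/KingCurrencyWindow` (p384458: `discAt_le_window`, `farUV_le`, `direct_matching_eventually`), whose window estimate it
re-derives with ONE HYPOTHESIS FEWER (the ε-END follows in `Spine/NE4/KingCurrencyGapEnd`).

THE POINT.  In `KingCurrencyWindow` (and in the pub-balaban NE7 #2 lineage's prior route «PAIR-CAUCHY», `Support/NE7Pairwise*`, whose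
weight sum `NE7PairwiseCouplingStep.sum_weightsOff_le_of_eventualLower` it consumes) the asymptotic-freedom lower bound
`EventualLowerH b γ k₀ β` is used TWICE: (a) to make the window feedback weights `(g^A_i)² g^B_{i+n}` SUMMABLE uniformly in the
cutoff (`king_fixedPoint` needs `Σ u_i ≤ U`, `C·U ≤ (1−θ)∕2`), and (b) to make the far-ultraviolet couplings small (`farUV_le`:
both runs' couplings `≤ 1∕√(1∕γ² + b·depth)` below the window).  Generation 13 recorded this as a LIMIT of (R51) («the AF lower-bound
binder is load-bearing (summable weights) — no rate-loss device without an output rate»).  THIS FILE REMOVES IT: the rate-loss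
device of the consecutive organisation (`T4CurrencyMatching.twoSided_fixedPoint_rateLoss`: sup-bounded weights, memory rate
strictly below the output rate) HAS a King-currency twin — a GROWING ENVELOPE.  Weighting the discrepancy at scale `j` by
`τ^{K−j}` (`θ < τ < 1`; the weight decays INTO the ultraviolet, i.e. the envelope `τ^{−depth}` grows away from the infrared pin),
the fading memory `θ^{age}` beats the envelope's growth, the window feedback closes with the SUP weight `γ³∕2` of the box
(`T4CouplingAnalyticity.abs_sub_le_of_window`: `|g − g′| ≤ (γ³∕2)|1∕g² − 1∕g′²|` on `]0,γ]`) under the ONE window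
`C·(γ³∕2)·τ∕(τ−θ) ≤ (1−τ)∕2` — LITERALLY the window of `T4CurrencyMatching.disc_le_of_fadingMemory_by` ∕ `injectedRate_of_runs_gap`
(there `ω < ρ`, here `θ < τ`) — and the far-ultraviolet couplings, bounded by `γ` ONLY (the box), reach a target scale at depth `≤ M`
below the pin through the factor `τ^{A}` of a buffer of `A` window scales.  NO lower bound on β, NO `b`, NO `k₀`, no summability.

WHAT IS KERNEL-CHECKED (elementary real analysis; NOTHING of Bałaban's asserted):
* §1 `king_fixedPoint_rateLoss` — THE INFRARED-ANCHORED FIXED POINT WITH A GROWING ENVELOPE: `x ≥ 0`, `x_K = 0`, for `J ≤ j < K`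
  `x_j ≤ x_{j+1} + ω_j + C·θ^{j−J}·Φ + C·Σ_{i∈[J,j]} θ^{j−i}·u_i x_i` with SUP-bounded weights `0 ≤ u_i ≤ ū`, `0 ≤ θ < τ < 1`,
  `C·ū·τ∕(τ−θ) ≤ (1−τ)∕2` ⟹ `x_j·τ^{K−j} ≤ 2·Σ_{i∈[J,K)} τ^{K−i}ω_i + 2(C∕(1−θ))·Φ·τ^{K−J}` on `[J, K]`
  (weighted window maximum `Y = max x_iτ^{K−i}`; the feedback at scale `j` is `≤ ū·Y·Σ(θ∕τ)^{j−i} ≤ ūYτ∕(τ−θ)` after the weight;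
  backward accumulation discounted by `τ^{i−j}`; absorb).  Compare `KingCurrency.king_fixedPoint` (`τ = 1`, summable weights).
* §2 `discAt_le_window_gap` — NODE U2 IN KING'S CURRENCY, AF-FREE: two runs of (0.20) `n` cutoffs apart, pinned, couplings in
  `]0,γ]`, `UniformShift ω γ β` (`ω ≥ 0`), `HistLipschitz Λ γ β`, `FadingMemory C θ Λ`, the window above ⟹ on `[J, K]`
  `|1∕(g^A_j)² − 1∕(g^B_{j+n})²|·τ^{K−j} ≤ 2·Σ_{i∈[J,K)} τ^{K−i}ω_i + 2(C∕(1−θ))·(Σ_{i<J} θ^{J−i}|g^B_{i+n} − g^A_i|)·τ^{K−J}`.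
* §3 `farUV_le_box` — the far-ultraviolet sum is `≤ γ·θ∕(1−θ)` by the BOX ALONE; `sum_Ico_pow_rev_le` (a reflected geometric sum).
The ε-END on a family of pinned runs (the conclusion of `KingCurrencyWindow.direct_matching_eventually` VERBATIM — matching at every
fixed depth `M`, uniformly in the gap `n` — without `EventualLowerH`, and under the memorable window `4·C·γ³ ≤ (1−θ)²` with
`τ = (1+θ)∕2`) is the sequel `Spine/NE4/KingCurrencyGapEnd` (`direct_matching_eventually_gap` ∕ `_free`): from §2–§3, a target scale
at depth `≤ M` sees the box-bounded far-ultraviolet term through `τ^{A}` (a buffer of `A` window scales) and the window sources through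
`ω → 0` against the fixed envelope loss `τ^{−M}`.

WHAT THIS SAYS FOR THE ROW (R52).  On King's route node U2's comparison step needs from the flow NO asymptotic freedom at all:
β-side {`UniformShift ω → 0` (or, by `KingCurrencyPointwise`, pointwise convergence of `β_k` along every fixed history + the memory
companion), `HistLipschitz` with `FadingMemory C θ`}, flow-side {runs in the box, the infrared pin}, and `γ` small against `C, θ`
([Balaban1987RG1] Thm 3 p. 264: «The constant γ depends on all other constants»).  The eventual lower bound on β survives only at
the DATA level (keeping tuned runs inside the box, `rgEqH_of_tuned`), not in the matching.  (R51)'s LIMIT (b) is withdrawn.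
NE4 PROPER unchanged: NOT PRINTED, NOT PROVED, DEPENDENT; spine PROVED 0∕9 before and after this file.

HONEST FRAMING.  Hypothesis SHAPES only (0 sorry, standard axioms); every β-side shape is an UNPRINTED binder; nothing of
Bałaban's is asserted or instantiated; rung (B)+1 on ONE finite T⁴ — NOT ℝ⁴, NOT infinite volume, NOT a mass gap, NOT Clay.

References (TYPES only): [Balaban1987RG1] = T. Bałaban, Commun. Math. Phys. **109** (1987) 249–301, (0.20) p. 256, Thm 2 p. 259,
Thm 3 p. 264, §5 p. 298; [King1986] = C. King, Commun. Math. Phys. **102** (1986) 649–677, (3.13) p. 657 (the pairwise organisation).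
-/

noncomputable section

namespace Summit.QuantumFields.BalabanUV.T4Continuum.Spine.NE4.KingCurrencyGap

open Finset Filter Topology
open Literature.MathematicalPhysics.QuantumFieldTheory.Balaban1983to89
open Literature.MathematicalPhysics.QuantumFieldTheory.Balaban1983to89.FlowStep
open Literature.MathematicalPhysics.QuantumFieldTheory.Balaban1983to89.T4CouplingMatching
open Summit.QuantumFields.BalabanUV.T4Continuum.Spine.NE4.KingCurrency
open Summit.QuantumFields.BalabanUV.T4Continuum.Spine.NE4.KingCurrencyAF (abs_sub_le_of_pos_le sum_range_pow_sub_le)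

/-! ## §1 The infrared-anchored fixed point with a growing envelope (sup-bounded weights; memory rate `θ` < envelope rate `τ`) -/

/-- A reflected geometric sum over a window: `Σ_{i∈[J,j]} r^{j−i} ≤ 1∕(1−r)` for `0 ≤ r < 1`. [folklore] -/
theorem sum_Ico_pow_rev_le {r : ℝ} (hr0 : 0 ≤ r) (hr1 : r < 1) (J j : ℕ) :
    ∑ i ∈ Ico J (j + 1), r ^ (j - i) ≤ 1 / (1 - r) := by
  have hrefl : ∑ i ∈ range (j + 1), r ^ (j - i) = ∑ m ∈ range (j + 1), r ^ m := by
    have h := Finset.sum_range_reflect (fun m => r ^ m) (j + 1)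
    simpa only [Nat.add_sub_cancel] using h
  have hgeom : ∑ m ∈ range (j + 1), r ^ m ≤ 1 / (1 - r) := by
    have h : ∑ m ∈ Ico 0 (j + 1), r ^ m ≤ r ^ 0 / (1 - r) := geom_sum_Ico_le_of_lt_one hr0 hr1
    rw [pow_zero] at h
    rwa [Finset.range_eq_Ico]
  calc ∑ i ∈ Ico J (j + 1), r ^ (j - i) ≤ ∑ i ∈ range (j + 1), r ^ (j - i) :=
        Finset.sum_le_sum_of_subset_of_nonneg
          (fun i hi => mem_range.mpr (Finset.mem_Ico.mp hi).2) fun _ _ _ => pow_nonneg hr0 _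
    _ = ∑ m ∈ range (j + 1), r ^ m := hrefl
    _ ≤ 1 / (1 - r) := hgeom

/-- **THE INFRARED-ANCHORED FIXED POINT WITH A GROWING ENVELOPE (rate loss in King's currency).**  Scales `0 … K`, a window
`[J, K]`; a nonnegative sequence `x` pinned at the infrared end (`x_K = 0`) with the backward recursion, for `J ≤ j < K`,
`x_j ≤ x_{j+1} + ω_j + C·θ^{j−J}·Φ + C·Σ_{i∈[J,j]} θ^{j−i}·(u_i x_i)`
(sources `ω ≥ 0`; far-ultraviolet input `Φ ≥ 0` through the fading memory; window feedback with SUP-BOUNDED weights `0 ≤ u_i ≤ ū` —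
NO summability), rates `0 ≤ θ < τ < 1`, and the window `C·ū·τ∕(τ−θ) ≤ (1−τ)∕2`.  THEN for every `j ∈ [J, K]`:
`x_j·τ^{K−j} ≤ 2·Σ_{i∈[J,K)} τ^{K−i}·ω_i + 2·(C∕(1−θ))·Φ·τ^{K−J}`.
Proof: the WEIGHTED window maximum `Y = max_i x_i τ^{K−i}` (an envelope `τ^{−depth}` growing away from the pin); the feedback at
scale `j`, times `τ^{K−j}`, is `≤ ū·Y·Σ_{i≤j}(θ∕τ)^{j−i} ≤ ū·Y·τ∕(τ−θ)` — the memory contracts faster than the envelope grows;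
backward accumulation from the pin, each later scale discounted by `τ^{i−j}` (`Σ ≤ 1∕(1−τ)`); absorb at the maximiser.  Twin of
`KingCurrency.king_fixedPoint` (there `τ = 1` and `Σ u_i ≤ U` — asymptotic freedom) exactly as
`T4CurrencyMatching.twoSided_fixedPoint_rateLoss` is the twin of `T4CouplingMatching.twoSided_fixedPoint`. [folklore] -/
theorem king_fixedPoint_rateLoss {K J : ℕ} (hJK : J ≤ K) {x ω u : ℕ → ℝ} {θ τ C ubar Φ : ℝ}
    (hθ0 : 0 ≤ θ) (hθτ : θ < τ) (hτ1 : τ < 1) (hC : 0 ≤ C) (hΦ : 0 ≤ Φ)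
    (hx : ∀ j, 0 ≤ x j) (hω : ∀ j, 0 ≤ ω j) (hu : ∀ i, 0 ≤ u i ∧ u i ≤ ubar)
    (hsmall : C * ubar * (τ / (τ - θ)) ≤ (1 - τ) / 2) (hK : x K = 0)
    (hrec : ∀ j, J ≤ j → j < K →
      x j ≤ x (j + 1) + ω j + C * θ ^ (j - J) * Φ
        + C * ∑ i ∈ Ico J (j + 1), θ ^ (j - i) * (u i * x i)) :
    ∀ j, J ≤ j → j ≤ K →
      x j * τ ^ (K - j) ≤ 2 * ∑ i ∈ Ico J K, τ ^ (K - i) * ω i + 2 * (C / (1 - θ)) * Φ * τ ^ (K - J) := by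
  have hτ0 : 0 < τ := lt_of_le_of_lt hθ0 hθτ
  have hτne : τ ≠ 0 := hτ0.ne'
  have h1τ : 0 < 1 - τ := by linarith
  have hτθ : 0 < τ - θ := by linarith
  have hτθne : τ - θ ≠ 0 := hτθ.ne'
  have h1θ : 0 < 1 - θ := by linarith
  have hθ1 : θ < 1 := hθτ.trans hτ1
  have hτpow : ∀ m : ℕ, 0 < τ ^ m := fun m => pow_pos hτ0 m
  have hubar : 0 ≤ ubar := (hu 0).1.trans (hu 0).2
  -- the weighted window maximum
  obtain ⟨js, hjs, hmax⟩ :=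
    Finset.exists_max_image (Icc J K) (fun i => x i * τ ^ (K - i)) ⟨J, Finset.mem_Icc.mpr ⟨le_rfl, hJK⟩⟩
  set Y := x js * τ ^ (K - js) with hY
  have hY0 : 0 ≤ Y := mul_nonneg (hx js) (hτpow _).le
  have hxY : ∀ i, J ≤ i → i ≤ K → x i * τ ^ (K - i) ≤ Y := fun i hi hiK =>
    hmax i (Finset.mem_Icc.mpr ⟨hi, hiK⟩)
  -- the window feedback at scale `j`, times the weight `τ^{K-j}`: memory `θ^{age}` against envelope `τ^{-age}`
  set R := ubar * Y * (τ / (τ - θ)) with hR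
  have hR0 : 0 ≤ R := by positivity
  have hfeed : ∀ j, J ≤ j → j ≤ K →
      τ ^ (K - j) * ∑ i ∈ Ico J (j + 1), θ ^ (j - i) * (u i * x i) ≤ R := by
    intro j hJj hjK
    have hterm : ∀ i ∈ Ico J (j + 1),
        τ ^ (K - j) * (θ ^ (j - i) * (u i * x i)) ≤ ubar * Y * (θ / τ) ^ (j - i) := by
      intro i hi
      have hJi : J ≤ i := (Finset.mem_Ico.mp hi).1
      have hij : i ≤ j := Nat.lt_succ_iff.mp (Finset.mem_Ico.mp hi).2
      have hiK : i ≤ K := hij.trans hjK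
      have e1 : τ ^ (K - i) = τ ^ (K - j) * τ ^ (j - i) := by
        rw [← pow_add]
        congr 1
        omega
      have e2 : τ ^ (K - j) * (θ ^ (j - i) * (u i * x i)) = u i * (x i * τ ^ (K - i)) * (θ / τ) ^ (j - i) := by
        rw [e1, div_pow]
        field_simp
      rw [e2]
      have h1 : u i * (x i * τ ^ (K - i)) ≤ ubar * Y :=
        mul_le_mul (hu i).2 (hxY i hJi hiK) (mul_nonneg (hx i) (hτpow _).le) hubar
      exact mul_le_mul_of_nonneg_right h1 (pow_nonneg (div_nonneg hθ0 hτ0.le) _)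
    have hgeo : ∑ i ∈ Ico J (j + 1), (θ / τ) ^ (j - i) ≤ 1 / (1 - θ / τ) :=
      sum_Ico_pow_rev_le (div_nonneg hθ0 hτ0.le) ((div_lt_one hτ0).mpr hθτ) J j
    have e3 : 1 / (1 - θ / τ) = τ / (τ - θ) := by
      field_simp
    calc τ ^ (K - j) * ∑ i ∈ Ico J (j + 1), θ ^ (j - i) * (u i * x i)
        = ∑ i ∈ Ico J (j + 1), τ ^ (K - j) * (θ ^ (j - i) * (u i * x i)) := by rw [Finset.mul_sum]
      _ ≤ ∑ i ∈ Ico J (j + 1), ubar * Y * (θ / τ) ^ (j - i) := Finset.sum_le_sum hterm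
      _ = ubar * Y * ∑ i ∈ Ico J (j + 1), (θ / τ) ^ (j - i) := by rw [Finset.mul_sum]
      _ ≤ ubar * Y * (τ / (τ - θ)) := by
          rw [← e3]
          exact mul_le_mul_of_nonneg_left hgeo (mul_nonneg hubar hY0)
      _ = R := rfl
  -- the per-scale increment and backward accumulation from the pin (as in `king_fixedPoint`)
  set s : ℕ → ℝ := fun j => ω j + C * θ ^ (j - J) * Φ + C * ∑ i ∈ Ico J (j + 1), θ ^ (j - i) * (u i * x i)
    with hs
  have hfb0 : ∀ j, 0 ≤ ∑ i ∈ Ico J (j + 1), θ ^ (j - i) * (u i * x i) := fun j =>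
    Finset.sum_nonneg fun i _ => mul_nonneg (pow_nonneg hθ0 _) (mul_nonneg (hu i).1 (hx i))
  have hs0 : ∀ j, 0 ≤ s j := fun j => by
    have h2 : 0 ≤ C * θ ^ (j - J) * Φ := mul_nonneg (mul_nonneg hC (pow_nonneg hθ0 _)) hΦ
    have h3 := hω j
    have h4 := mul_nonneg hC (hfb0 j)
    simp only [hs]
    linarith
  have hacc : ∀ j, J ≤ j → j ≤ K → x j ≤ ∑ i ∈ Ico j K, s i := by
    have hrec' : ∀ j, j < K → x (max j J) ≤ x (max (j + 1) J) + s j := by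
      intro j hj
      by_cases hJj : J ≤ j
      · rw [max_eq_left hJj, max_eq_left (by omega : J ≤ j + 1)]
        simp only [hs]
        have h := hrec j hJj hj
        linarith
      · have e1 : max j J = J := max_eq_right (by omega)
        have e2 : max (j + 1) J = J := max_eq_right (by omega)
        rw [e1, e2]
        linarith [hs0 j]
    have hKJ : x (max K J) ≤ 0 := by rw [max_eq_left hJK, hK]
    intro j hJj hjK
    have h := backward_sum (δ := fun j => x (max j J)) hKJ hrec' j hjK
    simp only [max_eq_left hJj] at h
    exact h
  -- the three accumulated pieces, each times the weight `τ^{K-j}`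
  set S := ∑ i ∈ Ico J K, τ ^ (K - i) * ω i with hSdef
  have hpieces : ∀ j, J ≤ j → j ≤ K →
      x j * τ ^ (K - j) ≤ S + C / (1 - θ) * Φ * τ ^ (K - J) + C * R / (1 - τ) := by
    intro j hJj hjK
    -- (a) sources, discounted
    have ha : τ ^ (K - j) * ∑ i ∈ Ico j K, ω i ≤ S := by
      rw [Finset.mul_sum]
      calc ∑ i ∈ Ico j K, τ ^ (K - j) * ω i ≤ ∑ i ∈ Ico j K, τ ^ (K - i) * ω i := by
            refine Finset.sum_le_sum fun i hi => ?_
            have hji : j ≤ i := (Finset.mem_Ico.mp hi).1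
            exact mul_le_mul_of_nonneg_right (pow_le_pow_of_le_one hτ0.le hτ1.le (by omega)) (hω i)
        _ ≤ S := Finset.sum_le_sum_of_subset_of_nonneg (Finset.Ico_subset_Ico hJj le_rfl)
            fun i _ _ => mul_nonneg (pow_nonneg hτ0.le _) (hω i)
    -- (b) the far-ultraviolet input through the fading memory, then the envelope
    have hb : τ ^ (K - j) * ∑ i ∈ Ico j K, C * θ ^ (i - J) * Φ ≤ C / (1 - θ) * Φ * τ ^ (K - J) := by
      have hgeo : ∑ i ∈ Ico j K, θ ^ (i - j) ≤ 1 / (1 - θ) := sum_Ico_pow_sub_le hθ0 hθ1 le_rfl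
      have e : ∑ i ∈ Ico j K, C * θ ^ (i - J) * Φ = C * Φ * θ ^ (j - J) * ∑ i ∈ Ico j K, θ ^ (i - j) := by
        rw [Finset.mul_sum]
        refine Finset.sum_congr rfl fun i hi => ?_
        have hji : j ≤ i := (Finset.mem_Ico.mp hi).1
        have e1 : θ ^ (i - J) = θ ^ (j - J) * θ ^ (i - j) := by
          rw [← pow_add]
          congr 1
          omega
        rw [e1]
        ring
      have hθτpow : θ ^ (j - J) ≤ τ ^ (j - J) := pow_le_pow_left₀ hθ0 hθτ.le _
      have eτ : τ ^ (K - j) * τ ^ (j - J) = τ ^ (K - J) := by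
        rw [← pow_add]
        congr 1
        omega
      have hCΦ : 0 ≤ C * Φ := mul_nonneg hC hΦ
      rw [e]
      calc τ ^ (K - j) * (C * Φ * θ ^ (j - J) * ∑ i ∈ Ico j K, θ ^ (i - j))
          ≤ τ ^ (K - j) * (C * Φ * τ ^ (j - J) * (1 / (1 - θ))) := by
            refine mul_le_mul_of_nonneg_left ?_ (hτpow _).le
            exact mul_le_mul (mul_le_mul_of_nonneg_left hθτpow hCΦ) hgeo
              (Finset.sum_nonneg fun _ _ => pow_nonneg hθ0 _) (mul_nonneg hCΦ (pow_nonneg hτ0.le _))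
        _ = C / (1 - θ) * Φ * (τ ^ (K - j) * τ ^ (j - J)) := by
            field_simp
        _ = C / (1 - θ) * Φ * τ ^ (K - J) := by rw [eτ]
    -- (c) the window feedback, discounted
    have hc : τ ^ (K - j) * ∑ i ∈ Ico j K, C * ∑ i' ∈ Ico J (i + 1), θ ^ (i - i') * (u i' * x i')
        ≤ C * R / (1 - τ) := by
      have hgeo : ∑ i ∈ Ico j K, τ ^ (i - j) ≤ 1 / (1 - τ) := sum_Ico_pow_sub_le hτ0.le hτ1 le_rfl
      rw [Finset.mul_sum]
      calc ∑ i ∈ Ico j K, τ ^ (K - j) * (C * ∑ i' ∈ Ico J (i + 1), θ ^ (i - i') * (u i' * x i'))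
          ≤ ∑ i ∈ Ico j K, τ ^ (i - j) * (C * R) := by
            refine Finset.sum_le_sum fun i hi => ?_
            have hji : j ≤ i := (Finset.mem_Ico.mp hi).1
            have hiK : i ≤ K := (Finset.mem_Ico.mp hi).2.le
            have hJi : J ≤ i := hJj.trans hji
            have e1 : τ ^ (K - j) = τ ^ (i - j) * τ ^ (K - i) := by
              rw [← pow_add]
              congr 1
              omega
            have hfi := hfeed i hJi hiK
            calc τ ^ (K - j) * (C * ∑ i' ∈ Ico J (i + 1), θ ^ (i - i') * (u i' * x i'))
                = τ ^ (i - j) * (C * (τ ^ (K - i) * ∑ i' ∈ Ico J (i + 1), θ ^ (i - i') * (u i' * x i'))) := by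
                  rw [e1]
                  ring
              _ ≤ τ ^ (i - j) * (C * R) :=
                  mul_le_mul_of_nonneg_left (mul_le_mul_of_nonneg_left hfi hC) (pow_nonneg hτ0.le _)
        _ = (∑ i ∈ Ico j K, τ ^ (i - j)) * (C * R) := by rw [Finset.sum_mul]
        _ ≤ 1 / (1 - τ) * (C * R) := mul_le_mul_of_nonneg_right hgeo (mul_nonneg hC hR0)
        _ = C * R / (1 - τ) := by
            field_simp
    -- combine
    have hsum : ∑ i ∈ Ico j K, s i
        = ∑ i ∈ Ico j K, ω i + ∑ i ∈ Ico j K, C * θ ^ (i - J) * Φ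
          + ∑ i ∈ Ico j K, C * ∑ i' ∈ Ico J (i + 1), θ ^ (i - i') * (u i' * x i') := by
      simp only [hs, Finset.sum_add_distrib]
    have hxj := hacc j hJj hjK
    have hτj := (hτpow (K - j)).le
    calc x j * τ ^ (K - j) ≤ (∑ i ∈ Ico j K, s i) * τ ^ (K - j) := mul_le_mul_of_nonneg_right hxj hτj
      _ = τ ^ (K - j) * ∑ i ∈ Ico j K, ω i + τ ^ (K - j) * ∑ i ∈ Ico j K, C * θ ^ (i - J) * Φ
          + τ ^ (K - j) * ∑ i ∈ Ico j K, C * ∑ i' ∈ Ico J (i + 1), θ ^ (i - i') * (u i' * x i') := by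
          rw [hsum]
          ring
      _ ≤ S + C / (1 - θ) * Φ * τ ^ (K - J) + C * R / (1 - τ) := add_le_add (add_le_add ha hb) hc
  -- absorb at the maximiser
  have hCR : C * R / (1 - τ) ≤ Y / 2 := by
    rw [hR, div_le_iff₀ h1τ]
    have : C * (ubar * Y * (τ / (τ - θ))) = (C * ubar * (τ / (τ - θ))) * Y := by ring
    rw [this]
    nlinarith [mul_le_mul_of_nonneg_right hsmall hY0]
  have hYle : Y ≤ S + C / (1 - θ) * Φ * τ ^ (K - J) + C * R / (1 - τ) :=
    hpieces js (Finset.mem_Icc.mp hjs).1 (Finset.mem_Icc.mp hjs).2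
  have hYfin : Y ≤ 2 * S + 2 * (C / (1 - θ)) * Φ * τ ^ (K - J) := by linarith
  intro j hJj hjK
  exact (hxY j hJj hjK).trans hYfin

/-! ## §2 Node U2 in King's currency WITHOUT the asymptotic-freedom binder -/

/-- **NODE U2 IN KING'S CURRENCY, AF-FREE (the direct matching of two pinned runs `n` cutoffs apart, on an infrared window, with
a growing envelope).**  Two runs of (0.20) with the SAME history-dependent family `β` — A: `K` steps, B: `K + n` steps — all
couplings in `]0,γ]`, pinned `g^A_K = g^B_{K+n}`; the King-currency input `UniformShift ω γ β` with `ω ≥ 0`; history moduli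
`HistLipschitz Λ γ β` with `FadingMemory C θ Λ` (`0 < θ`); an envelope rate `τ` with `θ < τ < 1`; the ONE window
`C·(γ³∕2)·τ∕(τ−θ) ≤ (1−τ)∕2` (that of `T4CurrencyMatching.injectedRate_of_runs_gap`; NO lower bound on β, NO weight sum).
THEN on every infrared window `[J, K]`, UNIFORMLY IN `n`:
`|1∕(g^A_j)² − 1∕(g^B_{j+n})²|·τ^{K−j} ≤ 2·Σ_{i∈[J,K)} τ^{K−i}·ω_i + 2(C∕(1−θ))·(Σ_{i<J} θ^{J−i}·|g^B_{i+n} − g^A_i|)·τ^{K−J}`.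
(`KingCurrency.discAt_step` + the box weight `T4CouplingAnalyticity.abs_sub_le_of_window` + `king_fixedPoint_rateLoss`.)
Every hypothesis about `β` is an UNPRINTED input. [cite: Balaban1987RG1, (0.20) p.256 and §5 p.298] -/
theorem discAt_le_window_gap {β : HBeta} {γ θ τ C : ℝ} {ω : ℕ → ℝ} {Λ : ℕ → ℕ → ℝ} {K n J : ℕ}
    {gA gB : ℕ → ℝ} (hγ : 0 < γ) (hθ0 : 0 < θ) (hθτ : θ < τ) (hτ1 : τ < 1) (hC : 0 ≤ C)
    (hω : ∀ j, 0 ≤ ω j)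
    (hA : RGEqH K β gA) (hB : RGEqH (K + n) β gB)
    (hAbox : ∀ i, i ≤ K → 0 < gA i ∧ gA i ≤ γ) (hBbox : ∀ i, i ≤ K + n → 0 < gB i ∧ gB i ≤ γ)
    (hpin : gA K = gB (K + n))
    (hS : UniformShift ω γ β) (hL : HistLipschitz Λ γ β) (hΛ : FadingMemory C θ Λ)
    (hsmall : C * (γ ^ 3 / 2) * (τ / (τ - θ)) ≤ (1 - τ) / 2) (hJK : J ≤ K) :
    ∀ j, J ≤ j → j ≤ K →
      discAt n gA gB j * τ ^ (K - j) ≤ 2 * ∑ i ∈ Ico J K, τ ^ (K - i) * ω i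
        + 2 * (C / (1 - θ)) * (∑ i ∈ range J, θ ^ (J - i) * |gB (i + n) - gA i|) * τ ^ (K - J) := by
  set u : ℕ → ℝ := fun _ => γ ^ 3 / 2 with hu
  have hw0 : 0 ≤ γ ^ 3 / 2 := by positivity
  have hu' : ∀ i, 0 ≤ u i ∧ u i ≤ γ ^ 3 / 2 := fun _ => ⟨hw0, le_rfl⟩
  set Φ := ∑ i ∈ range J, θ ^ (J - i) * |gB (i + n) - gA i| with hΦ
  have hΦ0 : 0 ≤ Φ := Finset.sum_nonneg fun i _ => mul_nonneg (pow_nonneg hθ0.le _) (abs_nonneg _)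
  refine king_fixedPoint_rateLoss hJK hθ0.le hθτ hτ1 hC hΦ0 (discAt_nonneg n gA gB) hω hu' hsmall
    (discAt_pin hpin) ?_
  intro j hJj hjK
  have hstep := discAt_step hA hB hAbox hBbox hS hL hjK
  -- split the history sum at `J`: far-ultraviolet scales through the fading memory, window scales through the box weight
  have hsplit : ∑ i ∈ range (j + 1), Λ j i * |gB (i + n) - gA i|
      = ∑ i ∈ range J, Λ j i * |gB (i + n) - gA i|
        + ∑ i ∈ Ico J (j + 1), Λ j i * |gB (i + n) - gA i| :=
    (Finset.sum_range_add_sum_Ico _ (by omega : J ≤ j + 1)).symm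
  have hfar : ∑ i ∈ range J, Λ j i * |gB (i + n) - gA i| ≤ C * θ ^ (j - J) * Φ := by
    rw [hΦ, Finset.mul_sum]
    refine Finset.sum_le_sum fun i hi => ?_
    have hiJ : i < J := mem_range.mp hi
    have hΛle := (hΛ j i (by omega)).2
    have e : θ ^ (j - i) = θ ^ (j - J) * θ ^ (J - i) := by
      rw [← pow_add]
      congr 1
      omega
    calc Λ j i * |gB (i + n) - gA i| ≤ C * θ ^ (j - i) * |gB (i + n) - gA i| :=
          mul_le_mul_of_nonneg_right hΛle (abs_nonneg _)
      _ = C * θ ^ (j - J) * (θ ^ (J - i) * |gB (i + n) - gA i|) := by rw [e]; ring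
  have hnear : ∑ i ∈ Ico J (j + 1), Λ j i * |gB (i + n) - gA i|
      ≤ C * ∑ i ∈ Ico J (j + 1), θ ^ (j - i) * (u i * discAt n gA gB i) := by
    rw [Finset.mul_sum]
    refine Finset.sum_le_sum fun i hi => ?_
    have hij : i ≤ j := Nat.lt_succ_iff.mp (Finset.mem_Ico.mp hi).2
    have hiK : i ≤ K := hij.trans hjK.le
    have hΛle := (hΛ j i hij).2
    have hgA := hAbox i hiK
    have hgB := hBbox (i + n) (by omega)
    have hcap : |gB (i + n) - gA i| ≤ u i * discAt n gA gB i := by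
      have h := T4CouplingAnalyticity.abs_sub_le_of_window hgB.1 hgB.2 hgA.1 hgA.2
      have hd : |(gB (i + n) ^ 2)⁻¹ - (gA i ^ 2)⁻¹| = discAt n gA gB i := by
        rw [discAt, one_div, one_div, abs_sub_comm]
      rw [hd] at h
      simpa only [hu] using h
    have hCθ : 0 ≤ C * θ ^ (j - i) := mul_nonneg hC (pow_nonneg hθ0.le _)
    calc Λ j i * |gB (i + n) - gA i| ≤ C * θ ^ (j - i) * (u i * discAt n gA gB i) :=
          mul_le_mul hΛle hcap (abs_nonneg _) hCθ
      _ = C * (θ ^ (j - i) * (u i * discAt n gA gB i)) := by ring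
  linarith [hstep, hsplit, hfar, hnear]

/-! ## §3 The far-ultraviolet term by the box alone -/

/-- **THE FAR-ULTRAVIOLET TERM BY THE BOX ALONE.**  Two runs with couplings in `]0,γ]` up to the scales used: for a window edge
`J ≤ K`, `Σ_{i<J} θ^{J−i}·|g^B_{i+n} − g^A_i| ≤ γ·θ∕(1−θ)` (`|Δg| ≤ γ` termwise, `Σ_{i<J} θ^{J−i} ≤ θ∕(1−θ)`).  Compare
`KingCurrencyWindow.farUV_le`, where asymptotic freedom makes this sum small; here it is merely bounded and the growing envelope
of §1 does the rest. [folklore] -/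
theorem farUV_le_box {γ θ : ℝ} {K n J : ℕ} {gA gB : ℕ → ℝ} (hγ : 0 ≤ γ) (hθ0 : 0 ≤ θ) (hθ1 : θ < 1)
    (hAbox : ∀ i, i ≤ K → 0 < gA i ∧ gA i ≤ γ) (hBbox : ∀ i, i ≤ K + n → 0 < gB i ∧ gB i ≤ γ) (hJK : J ≤ K) :
    ∑ i ∈ range J, θ ^ (J - i) * |gB (i + n) - gA i| ≤ γ * (θ / (1 - θ)) := by
  calc ∑ i ∈ range J, θ ^ (J - i) * |gB (i + n) - gA i| ≤ ∑ i ∈ range J, θ ^ (J - i) * γ := by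
        refine Finset.sum_le_sum fun i hi => ?_
        have hi' : i < J := mem_range.mp hi
        have hgA := hAbox i (by omega)
        have hgB := hBbox (i + n) (by omega)
        exact mul_le_mul_of_nonneg_left (abs_sub_le_of_pos_le hgB.1 hgB.2 hgA.1 hgA.2) (pow_nonneg hθ0 _)
    _ = (∑ i ∈ range J, θ ^ (J - i)) * γ := by rw [Finset.sum_mul]
    _ ≤ θ / (1 - θ) * γ := mul_le_mul_of_nonneg_right (sum_range_pow_sub_le hθ0 hθ1 J) hγ
    _ = γ * (θ / (1 - θ)) := mul_comm _ _

end Summit.QuantumFields.BalabanUV.T4Continuum.Spine.NE4.KingCurrencyGap
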